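import Mathlib
import Literature.Analysis.InnerProduct.OstrowskiCongruence
import HarnessLib

/-!
# Sorted eigenvalues of a non-negatively scaled symmetric matrix: `λ↓_j(c·A) = c·λ↓_j(A)` for `c ≥ 0`

Horn–Johnson, *Matrix Analysis* (2nd ed., CUP 2013), **Theorem 1.1.6** (held text `book:horn2012-matrix-analysis`
p0074): if `λ, x` is an eigenvalue–eigenvector pair of `A` then `p(λ), x` is one of `p(A)`; for the linear polynomial
`p(t) = c·t` with `c ≥ 0` the map is monotone, so Mathlib's DECREASING enumeration `eigenvalues₀` of a real symmetric
matrix is scaled index-wise (for `c < 0` the order would reverse; that case is not needed and not typed).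

Use (exact-arithmetic eigenvalue certificates): a certifier that scales the float matrix to integers,
`A = 2^s · G` rounded, certifies `λ↓_j(A)` and must divide by the scale; this is the door for that division.

Proof: Ostrowski's theorem in the tree's multiplicative operator form
(`Literature.Analysis.InnerProduct.exists_eigenvalues_congr_eq_mul`, Horn–Johnson Thm 4.5.9) with the congruence
`G = √c · id`, for which `‖Gx‖² = c‖x‖²` exactly, so `θ_k ∈ [c, c]`; through the definitional bridge
`Matrix.IsHermitian.eigenvalues₀ = (toEuclideanLin A).eigenvalues`.  No definitions, no named facts.
[HornJohnson2013, Thm 1.1.6; Thm 4.5.9]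
-/

noncomputable section

open scoped InnerProductSpace

namespace Literature.Analysis.Matrix

namespace EigenvalueCount

variable {ι : Type*} [Fintype ι] [DecidableEq ι]

/-- **Positive scaling of the sorted spectrum.** For a real symmetric `A` and `0 ≤ c`:
`λ↓_j(c • A) = c · λ↓_j(A)` for every index `j` of Mathlib's antitone enumeration `eigenvalues₀`.
[cite: HornJohnson2013, Thm 1.1.6; Thm 4.5.9 (Ostrowski, θ_k ∈ [c, c])] -/
theorem eigenvalues₀_smul_of_nonneg {A : Matrix ι ι ℝ} (hA : A.IsHermitian) {c : ℝ} (hc : 0 ≤ c)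
    (hcA : (c • A).IsHermitian) (j : Fin (Fintype.card ι)) :
    hcA.eigenvalues₀ j = c * hA.eigenvalues₀ j := by
  have hT : (Matrix.toEuclideanLin A).IsSymmetric := Matrix.isSymmetric_toEuclideanLin_iff.mpr hA
  have hS : (Matrix.toEuclideanLin (c • A)).IsSymmetric := Matrix.isSymmetric_toEuclideanLin_iff.mpr hcA
  have hSc : Matrix.toEuclideanLin (c • A) = c • Matrix.toEuclideanLin A := map_smul _ c A
  -- the congruence `G = √c · id`
  let G : EuclideanSpace ℝ ι →ₗ[ℝ] EuclideanSpace ℝ ι := Real.sqrt c • LinearMap.id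
  have hG : ∀ x : EuclideanSpace ℝ ι, G x = Real.sqrt c • x := fun x => rfl
  have hBG : ∀ x y : EuclideanSpace ℝ ι, ⟪Matrix.toEuclideanLin (c • A) x, y⟫_ℝ =
      ⟪Matrix.toEuclideanLin A (G x), G y⟫_ℝ := by
    intro x y
    rw [hSc, LinearMap.smul_apply, hG, hG, map_smul, real_inner_smul_left, real_inner_smul_left,
      real_inner_smul_right, ← mul_assoc, Real.mul_self_sqrt hc]
  have hnorm : ∀ x : EuclideanSpace ℝ ι, ‖G x‖ ^ 2 = c * ‖x‖ ^ 2 := by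
    intro x
    rw [hG, norm_smul, mul_pow, Real.norm_eq_abs, sq_abs, Real.sq_sqrt hc]
  obtain ⟨θ, h1, h2, h3⟩ := Literature.Analysis.InnerProduct.exists_eigenvalues_congr_eq_mul hT hS
    finrank_euclideanSpace G hBG (m := c) (M := c)
    (fun x => (hnorm x).symm.le) (fun x => (hnorm x).le) j
  have hθ : θ = c := le_antisymm h2 h1
  change hS.eigenvalues finrank_euclideanSpace j = c * hT.eigenvalues finrank_euclideanSpace j
  rw [h3, hθ]

/-- The division form used after certifying a SCALED integer matrix: `λ↓_j(A) = λ↓_j(s • A) / s` for `0 < s`.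
[cite: HornJohnson2013, Thm 1.1.6] -/
theorem eigenvalues₀_eq_smul_div {A : Matrix ι ι ℝ} (hA : A.IsHermitian) {s : ℝ} (hs : 0 < s)
    (hsA : (s • A).IsHermitian) (j : Fin (Fintype.card ι)) :
    hA.eigenvalues₀ j = hsA.eigenvalues₀ j / s := by
  rw [eigenvalues₀_smul_of_nonneg hA hs.le hsA j, mul_div_cancel_left₀ _ hs.ne']

/-- Enclosure transport through the scale: `λ↓_j(s • A) ∈ (a, b]` with `0 < s` ⇒ `λ↓_j(A) ∈ (a/s, b/s]`.
[cite: HornJohnson2013, Thm 1.1.6] -/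
theorem eigenvalues₀_mem_Ioc_of_smul_mem_Ioc {A : Matrix ι ι ℝ} (hA : A.IsHermitian) {s a b : ℝ} (hs : 0 < s)
    (hsA : (s • A).IsHermitian) (j : Fin (Fintype.card ι)) (h : hsA.eigenvalues₀ j ∈ Set.Ioc a b) :
    hA.eigenvalues₀ j ∈ Set.Ioc (a / s) (b / s) := by
  rw [eigenvalues₀_eq_smul_div hA hs hsA j]
  exact ⟨div_lt_div_of_pos_right h.1 hs, div_le_div_of_nonneg_right h.2 hs.le⟩

end EigenvalueCount

end Literature.Analysis.Matrix

end
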